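/-
Copyright (c) 2026. All rights reserved.
Released under Apache 2.0 license as described in the file LICENSE.
Authors: abc-iut cell, prover seat abc-iut-f-066 (gen 8; row «F3081 BUILD r1» B4, abc-iut-L4-lead m211/m212), over this seat's
B3 (`LogFrobeniusObservablesCompatibleOf.lean`) and the carrier lemmas of abc-iut-f-101 / abc-iut-w4-d095 / abc-iut-w5-d053 /
abc-iut-w5-d144 / abc-iut-L4-t3 / abc-iut-L4-t5 / abc-iut-f-095 and this seat's `LogFrobeniusSettingProdTS.lean`,
`LogFrobeniusAnTelecoreObservables{ArchGenuine,TwoSided}.lean` — every input consumed BY NAME; nothing restated.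
-/
import Literature.AnabelianGeometry.AbsoluteAnabelian.LogFrobeniusObservablesCompatibleOf
import Literature.AnabelianGeometry.AbsoluteAnabelian.LogFrobeniusAnTelecoreObservablesTwoSided
import Literature.AnabelianGeometry.AbsoluteAnabelian.LogFrobeniusAnTelecoreObservablesArchGenuine
import HarnessLib

/-!
# [AbsTopIII] Cor 5.5 (iii), last sentence on `D•⊢` (F-3081): the typed clause HOLDS at the genuine carriers of each place type and at ONE frozen setting carrying both

S. Mochizuki, *Topics in absolute anabelian geometry III: global reconstruction algorithms* [MochizukiAbsTopIII2015];
locators `p.N` = pages of the author's manuscript (`paper:url-5493eb38cbb7`), read on the page: Cor 5.5 (iii) p. 131 l. 30–40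
("the families of homotopies that constitute `S_log` and `S_log⊞` are compatible with one another as well as with the families of
homotopies that constitute the core and telecore structures of (i), (ii)"), Def 3.5 (ii)/(iii) p. 75, Rmk 3.5.1 p. 78.

PROOF-ONLY file (no definition, no instance, no named-fact hypothesis).  B3's sufficiency `cor55ObservablesCompatible_of`
(abc-iut-L4-t3's F-3081 `Cor55ObservablesCompatible` on `D•⊢`) has every binder DISCHARGED BY NAME at:
* abc-iut-f-101's genuine open-augmentation carrier `genuineOpen p V` (all places nonarchimedean): `hsq` abc-iut-w5-d053's
  `genuineOpen_iotaSquaresCommute`, `hι`/`hΛ` abc-iut-f-101's `nonarchGenuineMonoAnPfOpen_iotaOver/_lamOverLink`, `Hts v :=`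
  abc-iut-w5-d144's `logObsFamilyTS v T` (`isLogObservableTS_logObsFamilyTS`, `logObsFamilyTS_E_refl`, `isOver_logObsFamilyTS_η`
  for every `T` with `T.IotaOverTS` — in particular `genuineOpenTS`, abc-iut-L4-t3's `genuineOpenTS_iotaOverTS`);
* abc-iut-w4-d095's genuine-ARCHIMEDEAN carrier `archGenuine 𝔄 V isArc` (every Aut-holomorphic field functor, every `isArc`):
  abc-iut-f-095's `archGenuine_iotaSquaresCommute`, abc-iut-L4-t3's `archGenuine_iotaOver` / `archGenuineTS_iotaOverTS`,
  abc-iut-f-101's `archGenuine_lamOverLink`, this seat's `archGenuine_iotaSquaresCommuteTS`;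
* abc-iut-L4-t5's TWO-SIDED frozen product `genuineTwoSided p 𝔄 V isArc` (GENUINE rows at both place types): abc-iut-L4-t5's
  `genuineTwoSided_iotaSquaresCommute`, this seat's `genuineTwoSided_iotaOver / _lamOverLink / genuineTwoSidedTS /
  genuineTwoSidedTS_iotaOverTS / genuineTwoSided_iotaSquaresCommuteTS`.
Results: ★★ `cor55ObservablesCompatible_genuineOpen`, ★★ `cor55ObservablesCompatible_archGenuine`, ★★
`cor55ObservablesCompatible_genuineTwoSided` (each also `_of_iotaOverTS` for every `TS`-datum over `Th•[Z]`), the ∃-forms and the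
concrete geometric instance `HolRS.cor55ObservablesCompatible_genuineTwoSided_geometric`.
HONEST LABELS: MODEL-LEVEL at carriers of the cell's own construction; FROZEN interface (`ι⊞` at archimedean places indexed by the
frozen edge set — cell typing finding T3g9-F1; abc-iut-L4-lead m202: the frozen interface is the print reading for THIS sentence);
(L2) placeholder nonarchimedean rows of `archGenuine` at mixed indices; (P1) two-factor proxy of `Th•_T[Z]` for `genuineTwoSided`.
The typed statement is abc-iut-L4-t3's reading of the printed sentence (telecore compatibility is the separate row F-3757);
refereed pre-IUT material; nothing here bears on [IUTchIII] Cor. 3.12; no side taken; typed ≠ proved for print's theaters.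
-/

set_option autoImplicit false

universe u

open CategoryTheory Quiver

namespace Literature.AnabelianGeometry.AbsoluteAnabelian

namespace LogFrobeniusSetting

open AbsTopIII DiagramOfCategories

/-! ## At the genuine open-augmentation carrier (all places nonarchimedean) -/

section Open

variable (p : ℕ) [Fact p.Prime] (Vmod : Type 1)

/-- ★ **F-3081 at `genuineOpen p V` for every `TS`-datum `T` whose `ι` lie over `Th•[Z]`** (`V ≠ ∅`).
[cite: MochizukiAbsTopIII2015, Cor 5.5 (iii) p. 131] -/
theorem cor55ObservablesCompatible_genuineOpen_of_iotaOverTS [Nonempty Vmod] (T : (genuineOpen p Vmod).TSHomotopies)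
    (hT : T.IotaOverTS) : (genuineOpen p Vmod).Cor55ObservablesCompatible T :=
  (genuineOpen p Vmod).cor55ObservablesCompatible_of (genuineOpen_iotaSquaresCommute p Vmod) T
    (fun v => (genuineOpen p Vmod).logObsFamilyTS v T (genuineOpen_iotaSquaresCommuteTS p Vmod T v))
    (fun v => (genuineOpen p Vmod).isLogObservableTS_logObsFamilyTS v T (genuineOpen_iotaSquaresCommuteTS p Vmod T v))
    (fun v _ q => (genuineOpen p Vmod).logObsFamilyTS_E_refl v T _ q)
    (fun v _ _ _ h => (genuineOpen p Vmod).isOver_logObsFamilyTS_η v T hT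
      (nonarchGenuineMonoAnPfOpen_lamOverLink p Vmod (fun _ => false)) _ h)
    (nonarchGenuineMonoAnPfOpen_iotaOver p Vmod (fun _ => false)) (nonarchGenuineMonoAnPfOpen_lamOverLink p Vmod (fun _ => false))

/-- ★★ **F-3081 at `genuineOpen p V` with its own `TS`-datum** (abc-iut-L4-t3's `genuineOpenTS`; zero hypotheses beyond `V ≠ ∅`).
[cite: MochizukiAbsTopIII2015, Cor 5.5 (iii) p. 131] -/
theorem cor55ObservablesCompatible_genuineOpen [Nonempty Vmod] :
    (genuineOpen p Vmod).Cor55ObservablesCompatible (genuineOpenTS p Vmod) :=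
  cor55ObservablesCompatible_genuineOpen_of_iotaOverTS p Vmod (genuineOpenTS p Vmod) (genuineOpenTS_iotaOverTS p Vmod)

end Open

/-! ## At the genuine-archimedean carrier (every Aut-holomorphic field functor, every index) -/

section Arch

variable (𝔄 : AutHolFieldFunctor.{u}) (Vmod : Type (u + 1)) (isArc : Vmod → Bool)

/-- ★ **F-3081 at `archGenuine 𝔄 V isArc` for every `TS`-datum `T` with `T.IotaOverTS`** (`V ≠ ∅`).
[cite: MochizukiAbsTopIII2015, Cor 5.5 (iii) p. 131] -/
theorem cor55ObservablesCompatible_archGenuine_of_iotaOverTS [Nonempty Vmod] (T : (archGenuine 𝔄 Vmod isArc).TSHomotopies)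
    (hT : T.IotaOverTS) : (archGenuine 𝔄 Vmod isArc).Cor55ObservablesCompatible T :=
  (archGenuine 𝔄 Vmod isArc).cor55ObservablesCompatible_of (archGenuine_iotaSquaresCommute 𝔄 Vmod isArc) T
    (fun v => (archGenuine 𝔄 Vmod isArc).logObsFamilyTS v T (archGenuine_iotaSquaresCommuteTS 𝔄 Vmod isArc T v))
    (fun v => (archGenuine 𝔄 Vmod isArc).isLogObservableTS_logObsFamilyTS v T (archGenuine_iotaSquaresCommuteTS 𝔄 Vmod isArc T v))
    (fun v _ q => (archGenuine 𝔄 Vmod isArc).logObsFamilyTS_E_refl v T _ q)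
    (fun v _ _ _ h => (archGenuine 𝔄 Vmod isArc).isOver_logObsFamilyTS_η v T hT (archGenuine_lamOverLink 𝔄 Vmod isArc) _ h)
    (archGenuine_iotaOver 𝔄 Vmod isArc) (archGenuine_lamOverLink 𝔄 Vmod isArc)

/-- ★★ **F-3081 at `archGenuine 𝔄 V isArc` with its own `TS`-datum** (abc-iut-L4-t3's `archGenuineTS`; zero hypotheses beyond `V ≠ ∅`).
[cite: MochizukiAbsTopIII2015, Cor 5.5 (iii) p. 131] -/
theorem cor55ObservablesCompatible_archGenuine [Nonempty Vmod] :
    (archGenuine 𝔄 Vmod isArc).Cor55ObservablesCompatible (archGenuineTS 𝔄 Vmod isArc) :=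
  cor55ObservablesCompatible_archGenuine_of_iotaOverTS 𝔄 Vmod isArc (archGenuineTS 𝔄 Vmod isArc)
    (archGenuineTS_iotaOverTS 𝔄 Vmod isArc)

end Arch

/-! ## At ONE frozen setting with GENUINE rows at BOTH place types (abc-iut-L4-t5's product) -/

section TwoSided

variable (p : ℕ) [Fact p.Prime] (𝔄 : AutHolFieldFunctor.{0}) (Vmod : Type 1) (isArc : Vmod → Bool)

/-- ★ **F-3081 at `genuineTwoSided p 𝔄 V isArc` for every `TS`-datum `T` with `T.IotaOverTS`** (`V ≠ ∅`).
[cite: MochizukiAbsTopIII2015, Cor 5.5 (iii) p. 131] -/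
theorem cor55ObservablesCompatible_genuineTwoSided_of_iotaOverTS [Nonempty Vmod]
    (T : (genuineTwoSided p 𝔄 Vmod isArc).TSHomotopies) (hT : T.IotaOverTS) :
    (genuineTwoSided p 𝔄 Vmod isArc).Cor55ObservablesCompatible T :=
  (genuineTwoSided p 𝔄 Vmod isArc).cor55ObservablesCompatible_of (genuineTwoSided_iotaSquaresCommute p 𝔄 Vmod isArc) T
    (fun v => (genuineTwoSided p 𝔄 Vmod isArc).logObsFamilyTS v T (genuineTwoSided_iotaSquaresCommuteTS p 𝔄 Vmod isArc T v))
    (fun v => (genuineTwoSided p 𝔄 Vmod isArc).isLogObservableTS_logObsFamilyTS v T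
      (genuineTwoSided_iotaSquaresCommuteTS p 𝔄 Vmod isArc T v))
    (fun v _ q => (genuineTwoSided p 𝔄 Vmod isArc).logObsFamilyTS_E_refl v T _ q)
    (fun v _ _ _ h => (genuineTwoSided p 𝔄 Vmod isArc).isOver_logObsFamilyTS_η v T hT
      (genuineTwoSided_lamOverLink p 𝔄 Vmod isArc) _ h)
    (genuineTwoSided_iotaOver p 𝔄 Vmod isArc) (genuineTwoSided_lamOverLink p 𝔄 Vmod isArc)

/-- ★★ **F-3081 at the two-sided genuine setting with its own `TS`-datum** (this seat's `genuineTwoSidedTS`; zero hypotheses beyond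
`V ≠ ∅`). [cite: MochizukiAbsTopIII2015, Cor 5.5 (iii) p. 131] -/
theorem cor55ObservablesCompatible_genuineTwoSided [Nonempty Vmod] :
    (genuineTwoSided p 𝔄 Vmod isArc).Cor55ObservablesCompatible (genuineTwoSidedTS p 𝔄 Vmod isArc) :=
  cor55ObservablesCompatible_genuineTwoSided_of_iotaOverTS p 𝔄 Vmod isArc (genuineTwoSidedTS p 𝔄 Vmod isArc)
    (genuineTwoSidedTS_iotaOverTS p 𝔄 Vmod isArc)

end TwoSided

/-- Hence §5 settings of each kind — all-nonarchimedean, all-archimedean, two-sided with genuine rows at both place types — with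
nonempty index and a `TS`-datum satisfying the typed Cor 5.5 (iii) compatibility clause on `D•⊢` EXIST (model-level non-vacuity of
abc-iut-L4-t3's `Cor55ObservablesCompatible`). [cite: MochizukiAbsTopIII2015, Cor 5.5 (iii) p. 131] -/
theorem exists_twoSided_cor55ObservablesCompatible (p : ℕ) [Fact p.Prime] (𝔄 : AutHolFieldFunctor.{0}) (V₁ V₂ : Type 1)
    [Nonempty (V₁ ⊕ V₂)] :
    ∃ (L : LogFrobeniusSetting (V₁ ⊕ V₂) (Sum.elim (fun _ => false) (fun _ => true))) (T : L.TSHomotopies),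
      L.Cor55ObservablesCompatible T :=
  ⟨genuineTwoSided p 𝔄 (V₁ ⊕ V₂) _, genuineTwoSidedTS p 𝔄 (V₁ ⊕ V₂) _,
    cor55ObservablesCompatible_genuineTwoSided p 𝔄 (V₁ ⊕ V₂) _⟩

end LogFrobeniusSetting

/-! ## The concrete geometric instance -/

namespace HolRS

open LogFrobeniusSetting

/-- **Concrete**: at the geometric Aut-holomorphic field functor on connected Riemann surfaces, any prime, one nonarchimedean and one
archimedean place, the typed last sentence of Cor 5.5 (iii) on `D•⊢` holds at the two-sided genuine setting with its own `TS`-datum.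
[cite: MochizukiAbsTopIII2015, Cor 5.5 (iii) p. 131] -/
theorem cor55ObservablesCompatible_genuineTwoSided_geometric (p : ℕ) [Fact p.Prime] (Q : ObjectProperty HolRS) :
    (genuineTwoSided p (geometricAutHolFieldFunctor Q) (PUnit.{2} ⊕ PUnit.{2})
        (Sum.elim (fun _ => false) (fun _ => true))).Cor55ObservablesCompatible
      (genuineTwoSidedTS p (geometricAutHolFieldFunctor Q) (PUnit.{2} ⊕ PUnit.{2}) (Sum.elim (fun _ => false) (fun _ => true))) :=
  cor55ObservablesCompatible_genuineTwoSided p (geometricAutHolFieldFunctor Q) _ _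

end HolRS

end Literature.AnabelianGeometry.AbsoluteAnabelian
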